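import Literature.NumberTheory.EllipticCurves.Tamagawa
import Literature.NumberTheory.EllipticCurves.QuadraticTwist
import Literature.NumberTheory.DiophantineGeometry.TateAlgorithm
import HarnessLib

/-!
# Local data of a quadratic twist at `2` of an elliptic curve with good reduction over `ℚ₂`
# (Barrios–Roy–Sahajpal–Tallana–Tobin–Wiersema 2025, Thm. 5.1, rows `R = I₀`) — named fact

Topic `EllipticCurves`. Vocabulary reused, nothing re-declared: `WeierstrassCurve.quadraticTwist`
(`QuadraticTwist.lean`), `WeierstrassCurve.localTamagawaNumber` (`Tamagawa.lean`),
`WeierstrassCurve.kodairaSymbol` (`DiophantineGeometry/TateAlgorithm.lean`, Tate's algorithm run on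
the integral minimal model), Mathlib's `WeierstrassCurve.minimal`, `WeierstrassCurve.HasGoodReduction`,
`Padic`, `PadicInt`.

## Source and what is vendored

A. J. Barrios, M. Roy, N. Sahajpal, D. Tallana, B. Tobin, H. Wiersema, *Local data of elliptic
curves under quadratic twist*, Res. Number Theory **11** (2025), no. 3 (doi
10.1007/s40993-025-00650-w) = arXiv:2501.03209 (held `paper:arxiv-2501.03209`; locators `pNNNN Lnn`
below are the chunk files of that text). The paper determines, for an elliptic curve `E` over the
fraction field of a complete DVR with perfect residue field, the Kodaira–Néron type, minimal
discriminant valuation, conductor exponent and local Tamagawa number of the quadratic twist `E^d`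
from those of `E` (Tate's algorithm on "`v`-normal models", whose existence for every `E` is the
paper's Theorem 1 / Prop. 3.x, p0003 L12). Over `ℚ₂` (§5, Thm. 5.1 = Thm. 3 of the introduction,
p0003 L25–L26 and p0015 L21–L24, verbatim): *"Let `E/ℚ₂` be an elliptic curve given by a normal
model. For `d ∈ ℚ₂` with `v(d) = 0` (resp. `1`), let `E^d` denote the quadratic twist of `E` by `d`.
Then, Table [`v(d)=0` table] (resp. [`v(d)=1` table]) gives necessary and sufficient conditions on the Weierstrass coefficients
`aᵢ` of `E` to determine the Kodaira-Néron types of `E` and `E^d`. Additional conditions are also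
provided to determine the local Tamagawa numbers `c` and `c^d`, the minimal discriminant valuations
`δ` and `δ^d`, and conductor exponents `f` and `f^d` of `E` and `E^d`, respectively."* (`d` ranges
over `ℚ₂^× / (ℚ₂^×)²`, "Thus, we may assume that `v(d) ∈ {0, 1}`", p0015 L3.) The proof is a
case analysis on Tate's algorithm with a published SageMath verification of the valuation vectors
(p0018 L23–L26 "In the SageMath accompaniment to this proof [gittwists], we verify that
`𝒱(F⁰_{R,j})` is as given in the table"); refereed.

THIS FILE vendors ONLY the rows `R = typ(E) = I₀` (good reduction of `E`) of the two `ℚ₂` tables,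
verbatim (columns `R^d`, `(δ, δ^d)`, `(f, f^d)`, additional conditions, `(c, c^d)`):

* Table "Local data for `E/ℚ₂` and `E^d/ℚ₂` with `v(d) = 0`", row `I₀` (p0015 L35–L46):
  `d ≡ 1 mod 4`: `R^d = I₀`, `(0,0)`, `(0,0)`, `(1,1)`;
  `d ≡ 3 mod 4`, `v(a₁) = 0`: `R^d = I₄*`, `(0,12)`, `(0,4)`, `a₆ ≡ 1,2 mod 4 ↦ (1,2)`,
  `a₆ ≡ 0,3 mod 4 ↦ (1,4)`;
  `d ≡ 3 mod 4`, `v(a₁) ≥ 1`: `R^d = II*`, `(0,12)`, `(0,4)`, `(1,1)`.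
* Table "Local data for `E/ℚ₂` and `E^d/ℚ₂` with `v(d) = 1`", row `I₀` (p0016 L124–L133):
  `v(a₁) = 0`, `v(a₆) = 0`: `R^d = I₈*`, `(0,18)`, `(0,6)`, `v(P_{R,1}) = 4 ↦ (1,2)`, `≥ 5 ↦ (1,4)`;
  `v(a₁) = 0`, `v(a₆) ≥ 1`: `R^d = I₈*`, `(0,18)`, `(0,6)`, `v(P_{R,2}) = 4 ↦ (1,2)`, `≥ 5 ↦ (1,4)`;
  `v(a₁) ≥ 1`: `R^d = II`, `(0,6)`, `(0,6)`, `(1,1)`.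
  (Proof text for these rows: §5.1 Case 1, p0019 L82–L100; §5.2 Case 1, p0024 L6–L30.)

Hence, for `E/ℚ₂` with good reduction and a twist parameter whose square class is RAMIFIED
(`v(d) = 0 ∧ d ≡ 3 (mod 4)`, or `v(d) = 1`): `typ(E^d) ∈ {I₄*, II*}` resp. `{I₈*, II}` and
`c(E^d) ∈ {1, 2, 4}`; for the unramified class `d ≡ 1 (mod 4)`: `typ(E^d) = I₀`, `c(E^d) = 1`.

TRANSCRIPTION (weaker than print, never stronger): `E` any elliptic curve over Mathlib's `ℚ_[2]`
whose `ℤ_[2]`-minimal model has good reduction (the paper's normal model is one Weierstrass model of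
`E`; Kodaira type and `c` are isomorphism invariants — tree facts `kodairaSymbol_smul`,
`localTamagawaNumber_variableChange`); the twist parameter is specialised to a rational INTEGER `d`
with `d ≡ 1, 3 (mod 4)` (so `v(d) = 0`) or `d ≡ 2 (mod 4)` (so `v(d) = 1`), read in `ℚ_[2]`; the
twist is the tree's model `E.quadraticTwist d` (`y² = x³ + (d b₂/4)x² + (d² b₄/2)x + d³ b₆/4`,
`ℚ₂`-isomorphic to the paper's model (5.1) `y² = x³ + d(a₂² + 4a₂)x² + d²(8a₁a₃ + 16a₄)x +
d³(16a₃² + 64a₆)` `= (d b₂, 8d² b₄, 16d³ b₆)` by the scaling `u = 2^{∓1}`, both being the twist by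
`ℚ₂(√d)`); the conclusion keeps
the Kodaira symbol (as the UNION over the printed sub-rows, dropping the `v(a₁)` / `a₆` / `P_{R,j}`
refinements) and the set of printed Tamagawa values, and drops `(δ^d, f^d)`.
-- TODO(general form): `d ∈ ℚ₂^×` arbitrary (reduce to `v(d) ∈ {0,1}` by
-- `exists_variableChange_quadraticTwist_mul_sq`); the refinements by `v(a₁)` (ordinary /
-- supersingular reduction) and the printed `(δ^d, f^d) = (12, 4)`, `(18, 6)`, `(6, 6)`; the other
-- rows `R ≠ I₀` of the two `ℚ₂` tables and the odd-residue-characteristic Thm. 4.1.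

WHY A NAMED FACT (no `_holds`, size L): the tree's `kodairaSymbol` IS Tate's algorithm
(`kodairaSymbolOfMinimal`), so the Kodaira half is in principle a symbolic execution of Steps 1–10 on
a minimal model of the twist (the paper's normal models `F_{R,j}`), and the Tamagawa half then
follows from the tree's Step-3/7/10 index facts (`NeronComponentIndex.lean`); not attempted here.

CONSUMER (cell `b2b-bsdres`, team x11b3, LEAD DEAL #3 R2 "binder at 2"): for `E/ℚ` with good
reduction at `2` and an imaginary quadratic `K` with `2 ∣ d_K` (so `d_K = 4m`, `m ≡ 2, 3 (mod 4)`
squarefree, and `E^{(d_K)} ≅ E^{(m)}` over `ℚ` by `exists_variableChange_quadraticTwist_mul_sq`),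
`c₂(E^{(d_K)}) ∈ {1, 2, 4}`, in particular `3 ∤ c₂(E^{(d_K)})` — the hypothesis `hbind` of
`Summits/BirchSwinnertonDyer/Rank1Residual/X11b/Three/TamagawaTwistAnyDiscr.lean`; EVIDENCE already
on file there (kit j120590 / j119744: Kodaira types `{II, II*, I₄*, I₈*}`, `c₂ ∈ {1,2,4}` on
240 400 + 398 072 twists) agrees with the printed rows. The consumer theorem is the Summits seats'.

## References

* [BarriosEtAl2025] A. J. Barrios, M. Roy, N. Sahajpal, D. Tallana, B. Tobin, H. Wiersema, *Local
  data of elliptic curves under quadratic twist*, Res. Number Theory 11 (2025), no. 3,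
  doi:10.1007/s40993-025-00650-w; arXiv:2501.03209 — Thm. 5.1, the two tables "Local data for `E/ℚ₂`
  and `E^d/ℚ₂` with `v(d) = 0`" / "… with `v(d) = 1`" (rows `I₀`), §5.1 Case 1,
  §5.2 Case 1.
* [SilvermanATAEC1994] J. H. Silverman, *Advanced Topics in the Arithmetic of Elliptic Curves*,
  IV.9.4 (Tate's algorithm) and Table 4.1 (the values `c(I_n*) ∈ {2,4}`, `c(II) = c(II*) = 1`).
* S. Comalada, *Twists and reduction of an elliptic curve*, J. Number Theory 49 (1994) 45–62 (the
  earlier treatment cited by [BarriosEtAl2025]; not held, not used).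
-/

noncomputable section

open scoped Classical

namespace Literature.NumberTheory.EllipticCurves

open WeierstrassCurve Literature.NumberTheory.DiophantineGeometry

/-- **Barrios–Roy–Sahajpal–Tallana–Tobin–Wiersema 2025, Thm. 5.1, rows `R = I₀` of the tables "Local
data for `E/ℚ₂` and `E^d/ℚ₂` with `v(d) = 0`" and "… with `v(d) = 1`"
(local data of the quadratic twist at `2` of a curve with good reduction over `ℚ₂`).** Verbatim rows:
`v(d) = 0`: "`I₀` | `d ≡ 1 mod 4` | `I₀` | `(0,0)` | `(0,0)` | `(1,1)`"; "`d ≡ 3 mod 4` | `v(a₁) = 0` |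
`I₄*` | `(0,12)` | `(0,4)` | `a₆ ≡ 1,2 mod 4` `(1,2)`; `a₆ ≡ 0,3 mod 4` `(1,4)`"; "`v(a₁) ≥ 1` | `II*` |
`(0,12)` | `(0,4)` | `(1,1)`" (p0015 L35–L46). `v(d) = 1`: "`I₀` | `v(a₁) = 0` | `v(a₆) = 0` | `I₈*` |
`(0,18)` | `(0,6)` | `v(P_{R,1}) = 4` `(1,2)`; `v(P_{R,1}) ≥ 5` `(1,4)`"; "`v(a₆) ≥ 1` | `I₈*` | `(0,18)` |
`(0,6)` | `v(P_{R,2}) = 4` `(1,2)`; `≥ 5` `(1,4)`"; "`v(a₁) ≥ 1` | `II` | `(0,6)` | `(0,6)` | `(1,1)`"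
(p0016 L124–L133). TRANSCRIPTION: for an elliptic curve `E` over `ℚ_[2]` whose minimal model has good
reduction and an integer `d`: if `d ≡ 1 (mod 4)` the twist `E^{(d)}` has Kodaira symbol `I₀` and
`c = 1`; if `d ≡ 3 (mod 4)` it has Kodaira symbol `I₄*` or `II*` and `c ∈ {1, 2, 4}`; if
`d ≡ 2 (mod 4)` (`v(d) = 1`) it has Kodaira symbol `I₈*` or `II` and `c ∈ {1, 2, 4}`. Weaker than
print (integer `d`; union over the `v(a₁)`-sub-rows; `(δ^d, f^d)` dropped).
[cite: BarriosEtAl2025, Thm. 5.1 with the rows R = I₀ of the §5 tables for v(d) = 0 and v(d) = 1 (held text p0015 L35–L46, p0016 L124–L133); §5.1 Case 1, §5.2 Case 1] -/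
def BarriosEtAl2025_quadraticTwist_two_of_goodReduction : Prop :=
  ∀ (E : WeierstrassCurve ℚ_[2]) [E.IsElliptic], (E.minimal ℤ_[2]).HasGoodReduction ℤ_[2] →
    ∀ (d : ℤ),
      (d ≡ 1 [ZMOD 4] →
        (E.quadraticTwist (d : ℚ_[2])).kodairaSymbol ℤ_[2] = .I 0 ∧
          (E.quadraticTwist (d : ℚ_[2])).localTamagawaNumber ℤ_[2] = 1) ∧
      (d ≡ 3 [ZMOD 4] →
        ((E.quadraticTwist (d : ℚ_[2])).kodairaSymbol ℤ_[2] = .Istar 4 ∨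
            (E.quadraticTwist (d : ℚ_[2])).kodairaSymbol ℤ_[2] = .IIstar) ∧
          (E.quadraticTwist (d : ℚ_[2])).localTamagawaNumber ℤ_[2] ∈ ({1, 2, 4} : Set ℕ)) ∧
      (d ≡ 2 [ZMOD 4] →
        ((E.quadraticTwist (d : ℚ_[2])).kodairaSymbol ℤ_[2] = .Istar 8 ∨
            (E.quadraticTwist (d : ℚ_[2])).kodairaSymbol ℤ_[2] = .II) ∧
          (E.quadraticTwist (d : ℚ_[2])).localTamagawaNumber ℤ_[2] ∈ ({1, 2, 4} : Set ℕ))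

/-- **Corollary (the cell's "binder at `2`" shape): `3 ∤ c₂(E^{(d)})` for a twist parameter in a
ramified square class.** Under the fact, if `E/ℚ₂` has good reduction and `d ≡ 2` or `3 (mod 4)`,
then `3` does not divide the local Tamagawa number of `E^{(d)}` at `2` (it is `1`, `2` or `4`).
Bookkeeping on the printed Tamagawa column. [cite: BarriosEtAl2025, Thm. 5.1, §5 tables (v(d) = 0, 1), rows I₀] -/
theorem not_three_dvd_localTamagawaNumber_quadraticTwist_two_of_goodReduction
    (h : BarriosEtAl2025_quadraticTwist_two_of_goodReduction)
    (E : WeierstrassCurve ℚ_[2]) [E.IsElliptic] (hE : (E.minimal ℤ_[2]).HasGoodReduction ℤ_[2])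
    (d : ℤ) (hd : d ≡ 2 [ZMOD 4] ∨ d ≡ 3 [ZMOD 4]) :
    ¬ 3 ∣ (E.quadraticTwist (d : ℚ_[2])).localTamagawaNumber ℤ_[2] := by
  have hmem : (E.quadraticTwist (d : ℚ_[2])).localTamagawaNumber ℤ_[2] ∈ ({1, 2, 4} : Set ℕ) := by
    rcases hd with hd | hd
    · exact ((h E hE d).2.2 hd).2
    · exact ((h E hE d).2.1 hd).2
  simp only [Set.mem_insert_iff, Set.mem_singleton_iff] at hmem
  rcases hmem with hc | hc | hc <;> rw [hc] <;> decide

/-- **Corollary: the twist by an unramified unit class keeps `c₂ = 1`.** Under the fact, if `E/ℚ₂`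
has good reduction and `d ≡ 1 (mod 4)` then `c₂(E^{(d)}) = 1`. Bookkeeping on the printed row
"`d ≡ 1 mod 4` | `I₀` | `(1,1)`". [cite: BarriosEtAl2025, Thm. 5.1, §5 table (v(d) = 0), row I₀] -/
theorem localTamagawaNumber_quadraticTwist_two_eq_one_of_goodReduction_of_one_mod_four
    (h : BarriosEtAl2025_quadraticTwist_two_of_goodReduction)
    (E : WeierstrassCurve ℚ_[2]) [E.IsElliptic] (hE : (E.minimal ℤ_[2]).HasGoodReduction ℤ_[2])
    (d : ℤ) (hd : d ≡ 1 [ZMOD 4]) :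
    (E.quadraticTwist (d : ℚ_[2])).localTamagawaNumber ℤ_[2] = 1 :=
  ((h E hE d).1 hd).2

end Literature.NumberTheory.EllipticCurves

end
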